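import Literature.AlgebraicGeometry.ShimuraVarieties.UnitaryShimuraCurveHeckeHolds
import Literature.AlgebraicGeometry.ShimuraVarieties.UnitaryBallConePullbackTransport
import Literature.AlgebraicGeometry.HodgeTheory.ComplexPointsLifting
import Literature.AlgebraicGeometry.HodgeTheory.KaehlerClassPullbackAutomorphism
import Literature.AlgebraicGeometry.Motives.BettiRealization
import HarnessLib

/-!
# The Hecke translate of the unitary Shimura CURVE intertwines the cone uniformisations of the pieces: transport of the
# cone reading of forms ([Milne 2005] Lemma 5.13, §13 p. 118 for `Sh(U(J⋆), 𝔻)`; the geometric half of leg R5)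

Topic `AlgebraicGeometry/ShimuraVarieties`, namespace `…ShimuraVarieties.UnitaryCanonicalModel` (beside ★
`UnitaryShimuraCurveHecke{Points,Complex,Descent,Holds}`).  THEOREMS ONLY: no definition, no named fact, no instance, no
notation, no `sorry`; imports = tree only.

For the record system `S : RecordSystemGS L J⋆ τ K₀` of Deligne's canonical model of the Shimura CURVE `Sh(U(J⋆), 𝔻)` (★
`UnitaryShimuraCurveRecord`), levels `K, K' ≤ K₀`, `g ∈ U(J⋆)(𝔸_{L⁺,f})` with `g⁻¹Kg ≤ K'`, and ANY `L`-morphism `Tg : M_K ⟶ M_{K'}`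
that IS a Hecke translate (`S.IsHeckeTranslate K K' g Tg` — ★ `UnitaryShimuraCurveRecordMorphisms`: `[v, aK] ↦ [v, agK']` on complex
points; e.g. the CHOSEN translate `recordHeckeTranslateGS S hU7ₛ g K K' hK` of ★ `RecordCurveSec42Datum`∕`A3Liu418GSInstance`, whose
`c`-base change is the `tr` of `sec42HeckeTranslatesGS`), and any `pieces` data of the record at the two levels (representatives `g_q`,
`g'_{q'}`, disc-quotient pieces `ι_q : X_q → (M_K)_τ`, `ι'_{q'} : X'_{q'} → (M_{K'})_τ` with their `UnitaryBallUniformisationDatum 1`'s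
`B_q`, `B'_{q'}` — quantified as HYPOTHESES in the shape of the field ★ `RecordSystemGS.pieces`, so that a consumer instantiates them
with its own `obtain`):

* §1 `IsHeckeTranslate.map_baseChangeHom_map_apply` — the complex translate `T_ℂ := (Tg)_τ` acts on the uniformised points:
  `T_ℂ ((M_K)_τ-point of [v, aK]) = (M_{K'})_τ-point of [v, agK']` (★ `HodgeTheory.baseChangeEquiv_map`);
* §2 `map_comp_heckeBaseChange_unif_eq` — for a piece `q` of level `K`, a rational `γ` and a piece `q'` of level `K'` with
  `(γ_f · g_q g)⁻¹ · g'_{q'} ∈ K'` (the choice of ★ `exists_rational_inv_mul_rep_mem`; `exists_rep_inv_mul_mem` re-derives it here):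
  `(ι_q ≫ T_ℂ)(unif_q v) = ι'_{q'} (unif'_{q'} (γ^τ v))` on the cone — `T(g)` carries the piece `q` into the piece `q'` and INTERTWINES
  THE UNIFORMISATIONS with the matrix `M = γ^τ` ([Milne2005ShimuraVarieties] Lemma 5.13 p. 57: `[v, g_q g K'] = [γ^τ v, g'_{q'} K']`);
* §3 `exists_pieceHom_comp_eq` — the translate RESTRICTED TO THE PIECE is a morphism of the pieces: there is `f : X_q ⟶ X'_{q'}` with
  `f ≫ ι'_{q'} = ι_q ≫ T_ℂ` and `f(ℂ)(unif_q v) = unif'_{q'}(γ^τ v)` (★ `exists_hom_piece_ratToGLℂ` gives `f` with the point formula;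
  the equation of morphisms holds because both sides agree on complex points — §2 — and `X_q` is reduced, `(M_{K'})_τ` separated:
  ★ `SchemeOver.hom_ext_of_forall_algPoints`, [MumfordAV1970, §4]);
* §4 `pullback_coneDeriv_ratToGLℂ_eq` — THE TRANSPORT: for Hodge models `A'` of `X'_{q'}`, `A₁` of `X_q`, any such `f` and any
  complex `k`-form `α` on `X'^an_{q'}`, the cone reading of `(f^an)^* α` in the group variable at `u` equals the cone reading of `α`
  at `γ^τ · u` (★ `UnitaryBallUniformisationDatum.pullback_coneDeriv_mulVec_eq'`, M4a, with `M := γ^τ`, which preserves the common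
  cone `negCone (J⋆^τ)`), and §5: `(ι_q ≫ T_ℂ)(ℂ)^* c = f(ℂ)^* (ι'_{q'}(ℂ)^* c)` on complex
  Betti classes of the (non-connected) curve (`singularCohomology_map_mapContinuous_eq_of_comp_eq`, ★ `AlgPoints.mapContinuous_comp`), and
  the form-level companion `pullback_anMap_eq_pullback_pullback_of_comp_eq` for smooth projective (connected) targets (★
  `HodgeModel.anMap_comp_apply`, ★ `MForm.pullback_comp`).

Together with ★ `UnitaryGroupAdelicLiftTranslate` §4 (the adelic function whose level-`K` piece functions are `u ↦ f'_{q'}(σ(γ)·u)` is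
the right translate `R_g` of the lift of the `f'`), this is leg R5 (Hecke equivariance `r ∘ Alb(T_g)^* = R_g ∘ r`) of the realisation
of `H¹` of the curve tower in cotangent automorphic forms (cell `hodgecm-mathlib`, P5 line `F0_AlbCm`, sub-line S1-R), up to the
functoriality of the Hodge `(1,0)`-projection ∕ `oneFormOfClass` under `f^an` between the (connected, smooth projective) PIECES, which
is glue of the realisation's definition.

## References
* [Milne2005ShimuraVarieties] J. S. Milne, *Introduction to Shimura varieties* (2005/2017): §5 p. 57 L7–12, p. 58 L3–11, Lemma 5.13
  p. 57, §13 p. 118 L21–26 (the translate `T(g)`), Thm. 13.6.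
* [Deligne1979ShimuraVarieties] P. Deligne, Corvallis PSPM 33.2 (1979), 2.1.2–2.1.4 (the pieces `Γ_g \ X⁺`).
* [MumfordAV1970] D. Mumford, *Abelian varieties* (1970), §4 (a morphism from a reduced variety is determined by its points).
* [SerreGAGA1956] J.-P. Serre, GAGA (1956), §2 n°5 (functoriality of `X^h`).
* [VoisinHodgeI2002] C. Voisin, *Hodge Theory and Complex Algebraic Geometry I* (2002), §2.2.1, §7.3.2 (pull-back of forms).
* [HatcherAT2002] A. Hatcher, *Algebraic Topology* (2002), §3.1 (functoriality of singular cohomology).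
* [BergeronMillsonMoeglin2016Balls] N. Bergeron, J. Millson, C. Moeglin, Acta Math. 216 (2016), Part 2 §1.3 (the negative cone).
-/

set_option autoImplicit false

noncomputable section

open Function MulAction Topology NumberField CategoryTheory Matrix AlgebraicGeometry
open scoped Matrix ComplexOrder Manifold
open Literature.AlgebraicGeometry.Motives
open Literature.NumberTheory.Automorphic Literature.NumberTheory.Automorphic.UnitaryGroup
open Literature.NumberTheory.Automorphic.Liu2021.AppendixC (C5.OpenCompactSubgroup C5.SmallLevel)
open Literature.AlgebraicGeometry.HodgeTheory (HodgeModel)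
open Literature.Geometry.Kaehler (MForm)

namespace Literature.AlgebraicGeometry.ShimuraVarieties.UnitaryCanonicalModel

variable {L : Type} [Field L] [NumberField L] [IsCMField L] {Jstar : Matrix (Fin 2) (Fin 2) L} {τ : L →+* ℂ}
  {K₀ : C5.OpenCompactSubgroup ↥(finAdelic (↥(maximalRealSubfield L)) L (IsCMField.complexConj L) 2 Jstar)}

/-! ### §1. The complex translate on the uniformised points -/

/-- **`T_ℂ` on points**: for an `L`-morphism `Tg : M_K ⟶ M_{K'}` that is a Hecke translate and `T_ℂ := (Tg)_τ` its base change to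
`ℂ`, the `(M_K)_τ`-point of `[v, aK]` goes to the `(M_{K'})_τ`-point of `[v, agK']` (naturality of `M(ℂ)_{along τ} = M_τ(ℂ)`,
★ `HodgeTheory.baseChangeEquiv_map`). [cite: Milne2005ShimuraVarieties, §13 p. 118 L21–26] -/
theorem RecordSystemGS.IsHeckeTranslate.map_baseChangeHom_map_apply {S : RecordSystemGS L Jstar τ K₀} {K K' : C5.SmallLevel K₀}
    {g : ↥(finAdelic (↥(maximalRealSubfield L)) L (IsCMField.complexConj L) 2 Jstar)} {Tg : S.M.obj K ⟶ S.M.obj K'}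
    (hT : S.IsHeckeTranslate K K' g Tg) (v : Fin 2 → ℂ) (hv : v ∈ negCone (Jstar.map τ))
    (a : ↥(finAdelic (↥(maximalRealSubfield L)) L (IsCMField.complexConj L) 2 Jstar)) :
    letI : Algebra L ℂ := τ.toAlgebra
    AlgPoints.map ((Motives.baseChangeHom τ).map Tg)
        (AlgPoints.baseChangeEquiv τ (S.M.obj K) ((S.pts K).symm (ShimuraSetGS.mk L Jstar τ K.1.1 v hv a))) =
      AlgPoints.baseChangeEquiv τ (S.M.obj K') ((S.pts K').symm (ShimuraSetGS.mk L Jstar τ K'.1.1 v hv (a * g))) := by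
  letI : Algebra L ℂ := τ.toAlgebra
  have h := hT v hv a
  have h' : AlgPoints.map Tg ((S.pts K).symm (ShimuraSetGS.mk L Jstar τ K.1.1 v hv a)) =
      (S.pts K').symm (ShimuraSetGS.mk L Jstar τ K'.1.1 v hv (a * g)) := by
    rw [← h, Homeomorph.symm_apply_apply]
  rw [← HodgeTheory.baseChangeEquiv_map Tg, h']

/-! ### §2. The translate carries the piece `q` into the piece `q'` and intertwines the uniformisations with `γ^τ` -/

/-- `γ^τ v` is negative when `v` is (★ `smul_ratToGLℂ_mulVec_mem_negCone` at `c = 1`). [cite: BergeronMillsonMoeglin2016Balls, Part 2 §1.3] -/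
theorem ratToGLℂ_mulVec_mem_negCone' (γ : ↥(rational (↥(maximalRealSubfield L)) L (IsCMField.complexConj L) 2 Jstar))
    {v : Fin 2 → ℂ} (hv : v ∈ negCone (Jstar.map τ)) :
    ((ratToGLℂ L Jstar τ γ : GL (Fin 2) ℂ) : Matrix (Fin 2) (Fin 2) ℂ) *ᵥ v ∈ negCone (Jstar.map τ) := by
  simpa only [one_smul] using smul_ratToGLℂ_mulVec_mem_negCone L Jstar τ γ one_ne_zero hv

omit [IsCMField L] in
/-- For every piece `q` of level `K` there are a rational `γ` and a piece `q'` of level `K'` with `(γ_f · g_q g)⁻¹ · g'_{q'} ∈ K'`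
(`q' = [g_q g]`; ★ `exists_rational_inv_mul_rep_mem`). [cite: Milne2005ShimuraVarieties, Lemma 5.13 p. 57 and §13 p. 118 L21–26] -/
theorem exists_rep_inv_mul_mem {c : L ≃ₐ[↥(maximalRealSubfield L)] L}
    {K' : Subgroup ↥(finAdelic (↥(maximalRealSubfield L)) L c 2 Jstar)}
    {gq' : orbitRel.Quotient ↥(rational (↥(maximalRealSubfield L)) L c 2 Jstar)
        (ShimuraDissection.CosetSpace (rationalToFinAdelic (↥(maximalRealSubfield L)) L c 2 Jstar) K') →
      ↥(finAdelic (↥(maximalRealSubfield L)) L c 2 Jstar)}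
    (hgq' : ∀ q', Quotient.mk'' (ShimuraDissection.CosetSpace.pt (rationalToFinAdelic (↥(maximalRealSubfield L)) L c 2 Jstar) K' (gq' q')) = q')
    (b g : ↥(finAdelic (↥(maximalRealSubfield L)) L c 2 Jstar)) :
    ∃ (γ : ↥(rational (↥(maximalRealSubfield L)) L c 2 Jstar))
      (q' : orbitRel.Quotient ↥(rational (↥(maximalRealSubfield L)) L c 2 Jstar)
        (ShimuraDissection.CosetSpace (rationalToFinAdelic (↥(maximalRealSubfield L)) L c 2 Jstar) K')),
      (rationalToFinAdelic (↥(maximalRealSubfield L)) L c 2 Jstar γ * (b * g))⁻¹ * gq' q' ∈ K' :=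
  let ⟨γ, hγ⟩ := exists_rational_inv_mul_rep_mem hgq' (b * g)
  ⟨γ, _, hγ⟩

section Pieces

variable {S : RecordSystemGS L Jstar τ K₀} {K K' : C5.SmallLevel K₀}
  {g : ↥(finAdelic (↥(maximalRealSubfield L)) L (IsCMField.complexConj L) 2 Jstar)} {Tg : S.M.obj K ⟶ S.M.obj K'}
  -- pieces at level `K`
  {Q : Type} {gq : Q → ↥(finAdelic (↥(maximalRealSubfield L)) L (IsCMField.complexConj L) 2 Jstar)} {X : Q → SchemeOver ℂ}
  {ι : ∀ q, X q ⟶ (letI : Algebra L ℂ := τ.toAlgebra; (Motives.baseChangeHom τ).obj (S.M.obj K))}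
  {B : ∀ q, UnitaryBallUniformisationDatum 1 (X q)}
  -- pieces at level `K'`
  {Q' : Type} {gq' : Q' → ↥(finAdelic (↥(maximalRealSubfield L)) L (IsCMField.complexConj L) 2 Jstar)} {X' : Q' → SchemeOver ℂ}
  {ι' : ∀ q', X' q' ⟶ (letI : Algebra L ℂ := τ.toAlgebra; (Motives.baseChangeHom τ).obj (S.M.obj K'))}
  {B' : ∀ q', UnitaryBallUniformisationDatum 1 (X' q')}

/-- **`(ι_q ≫ T_ℂ)(unif_q v) = ι'_{q'}(unif'_{q'}(γ^τ v))`** on the cone: the Hecke translate carries the piece `q` of `(M_K)_τ` into the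
piece `q'` of `(M_{K'})_τ` and intertwines the two cone uniformisations with `M = γ^τ`, as soon as `(γ_f · g_q g)⁻¹ · g'_{q'} ∈ K'`
(`[v, g_q K] ↦ [v, g_q g K'] = [γ^τ v, g'_{q'} K']`). [cite: Milne2005ShimuraVarieties, Lemma 5.13 p. 57 and §13 p. 118 L21–26]
[cite: Deligne1979ShimuraVarieties, 2.1.2] -/
theorem map_comp_heckeBaseChange_unif_eq (hT : S.IsHeckeTranslate K K' g Tg)
    (hB : letI : Algebra L ℂ := τ.toAlgebra
      ∀ q, (B q).Hℂ = Jstar.map τ ∧ ∀ (v : Fin 2 → ℂ) (hv : v ∈ negCone (Jstar.map τ)),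
        AlgPoints.map (ι q) ((B q).unif v) =
          AlgPoints.baseChangeEquiv τ (S.M.obj K) ((S.pts K).symm (ShimuraSetGS.mk L Jstar τ K.1.1 v hv (gq q))))
    (hB' : letI : Algebra L ℂ := τ.toAlgebra
      ∀ q', (B' q').Hℂ = Jstar.map τ ∧ ∀ (v : Fin 2 → ℂ) (hv : v ∈ negCone (Jstar.map τ)),
        AlgPoints.map (ι' q') ((B' q').unif v) =
          AlgPoints.baseChangeEquiv τ (S.M.obj K') ((S.pts K').symm (ShimuraSetGS.mk L Jstar τ K'.1.1 v hv (gq' q'))))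
    {q : Q} {q' : Q'} {γ : ↥(rational (↥(maximalRealSubfield L)) L (IsCMField.complexConj L) 2 Jstar)}
    (hγ : ((rationalToFinAdelic (↥(maximalRealSubfield L)) L (IsCMField.complexConj L) 2 Jstar γ :
        ↥(finAdelic (↥(maximalRealSubfield L)) L (IsCMField.complexConj L) 2 Jstar)) * (gq q * g))⁻¹ * gq' q' ∈ K'.1.1)
    (v : Fin 2 → ℂ) (hv : v ∈ (B q).cone) :
    letI : Algebra L ℂ := τ.toAlgebra
    AlgPoints.map (ι q ≫ (Motives.baseChangeHom τ).map Tg) ((B q).unif v) =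
      AlgPoints.map (ι' q') ((B' q').unif (((ratToGLℂ L Jstar τ γ : GL (Fin 2) ℂ) : Matrix (Fin 2) (Fin 2) ℂ) *ᵥ v)) := by
  letI : Algebra L ℂ := τ.toAlgebra
  have hv' : v ∈ negCone (Jstar.map τ) := by
    have h := hv
    change v ∈ negCone (B q).Hℂ at h
    rwa [(hB q).1] at h
  have hγv := ratToGLℂ_mulVec_mem_negCone' (τ := τ) γ hv'
  rw [AlgPoints.map_comp_apply, (hB q).2 v hv', hT.map_baseChangeHom_map_apply v hv' (gq q),
    ShimuraSetGS.mk_eq_mk_ratToGLℂ_mulVec_of_mem L Jstar τ K'.1.1 γ v hv' hγv hγ, (hB' q').2 _ hγv]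

/-! ### §3. The translate restricted to a piece is a morphism of the pieces -/

/-- **The piece morphism under the translate**: with `g⁻¹Kg ≤ K'`, the levels of the pieces read as `τ(Γ_{J⋆}(g_q K g_q⁻¹))`,
`τ(Γ_{J⋆}(g'_{q'} K' g'_{q'}⁻¹))` (the `pieces` clause) and `(γ_f · g_q g)⁻¹ · g'_{q'} ∈ K'`, there is a `ℂ`-morphism
`f : X_q ⟶ X'_{q'}` with `f(ℂ)(unif_q v) = unif'_{q'}(γ^τ v)` on the cone (★ `exists_hom_piece_ratToGLℂ`) AND `f ≫ ι'_{q'} = ι_q ≫ T_ℂ`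
(both sides agree on every complex point of the reduced curve `X_q` — §2 and `unif_q` is onto — and `(M_{K'})_τ` is separated:
★ `SchemeOver.hom_ext_of_forall_algPoints`). [cite: Milne2005ShimuraVarieties, §13 p. 118 L21–26] [cite: MumfordAV1970, §4] -/
theorem exists_pieceHom_comp_eq (hT : S.IsHeckeTranslate K K' g Tg) (hK : ∀ k ∈ K.1.1, g⁻¹ * k * g ∈ K'.1.1)
    (hB : letI : Algebra L ℂ := τ.toAlgebra
      ∀ q, (B q).Hℂ = Jstar.map τ ∧
        (B q).Γ.map (Matrix.GeneralLinearGroup.map ((B q).τ₁ : ↥(B q).E →+* ℂ)) =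
          (arithmeticLevel (↥(maximalRealSubfield L)) L (IsCMField.complexConj L) 2 Jstar
            (K.1.1.map (MulAut.conj (gq q)).toMonoidHom)).map (Matrix.GeneralLinearGroup.map τ) ∧
        ∀ (v : Fin 2 → ℂ) (hv : v ∈ negCone (Jstar.map τ)),
          AlgPoints.map (ι q) ((B q).unif v) =
            AlgPoints.baseChangeEquiv τ (S.M.obj K) ((S.pts K).symm (ShimuraSetGS.mk L Jstar τ K.1.1 v hv (gq q))))
    (hB' : letI : Algebra L ℂ := τ.toAlgebra
      ∀ q', (B' q').Hℂ = Jstar.map τ ∧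
        (B' q').Γ.map (Matrix.GeneralLinearGroup.map ((B' q').τ₁ : ↥(B' q').E →+* ℂ)) =
          (arithmeticLevel (↥(maximalRealSubfield L)) L (IsCMField.complexConj L) 2 Jstar
            (K'.1.1.map (MulAut.conj (gq' q')).toMonoidHom)).map (Matrix.GeneralLinearGroup.map τ) ∧
        ∀ (v : Fin 2 → ℂ) (hv : v ∈ negCone (Jstar.map τ)),
          AlgPoints.map (ι' q') ((B' q').unif v) =
            AlgPoints.baseChangeEquiv τ (S.M.obj K') ((S.pts K').symm (ShimuraSetGS.mk L Jstar τ K'.1.1 v hv (gq' q'))))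
    {q : Q} {q' : Q'} {γ : ↥(rational (↥(maximalRealSubfield L)) L (IsCMField.complexConj L) 2 Jstar)}
    (hγ : ((rationalToFinAdelic (↥(maximalRealSubfield L)) L (IsCMField.complexConj L) 2 Jstar γ :
        ↥(finAdelic (↥(maximalRealSubfield L)) L (IsCMField.complexConj L) 2 Jstar)) * (gq q * g))⁻¹ * gq' q' ∈ K'.1.1) :
    letI : Algebra L ℂ := τ.toAlgebra
    ∃ f : X q ⟶ X' q',
      (∀ v ∈ (B q).cone, AlgPoints.map f ((B q).unif v) =
        (B' q').unif (((ratToGLℂ L Jstar τ γ : GL (Fin 2) ℂ) : Matrix (Fin 2) (Fin 2) ℂ) *ᵥ v)) ∧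
      f ≫ ι' q' = ι q ≫ (Motives.baseChangeHom τ).map Tg := by
  letI : Algebra L ℂ := τ.toAlgebra
  have hγ' : ((rationalToFinAdelic (↥(maximalRealSubfield L)) L (IsCMField.complexConj L) 2 Jstar γ :
        ↥(finAdelic (↥(maximalRealSubfield L)) L (IsCMField.complexConj L) 2 Jstar)) * gq q * g)⁻¹ * gq' q' ∈ K'.1.1 := by
    rwa [mul_assoc]
  obtain ⟨f, hf⟩ := exists_hom_piece_ratToGLℂ (B q) (B' q') (hB q).1 (hB' q').1 (hB q).2.1 (hB' q').2.1 hK γ hγ'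
  refine ⟨f, hf, ?_⟩
  -- both sides agree on complex points; `X q` is reduced of finite type, the target separated
  haveI := (B q).isSmoothProjective.smoothOfRelativeDimension
  haveI : Smooth (X q).hom := SmoothOfRelativeDimension.smooth 1 (X q).hom
  haveI : IsReduced (X q).left := isReduced_of_smooth_over_field (X q).hom
  haveI : IsProper ((Motives.baseChangeHom τ).obj (S.M.obj K')).hom := (S.projective_complexFibre K').isProper
  refine SchemeOver.hom_ext_of_forall_algPoints ℂ fun P => ?_
  obtain ⟨v, hv, rfl⟩ := (B q).surjOn_unif (Set.mem_univ P)
  rw [← AlgPoints.map_apply, ← AlgPoints.map_apply, AlgPoints.map_comp_apply, hf v hv,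
    map_comp_heckeBaseChange_unif_eq hT (fun q => ⟨(hB q).1, (hB q).2.2⟩) (fun q' => ⟨(hB' q').1, (hB' q').2.2⟩) hγ v hv]

/-! ### §4. Transport of the cone reading of forms along the translate -/

/-- **THE TRANSPORT (cone road, leg R5)**: for Hodge models `A'` of the piece `X'_{q'}` and `A₁` of the piece `X_q`, any `ℂ`-morphism
`f : X_q ⟶ X'_{q'}` with `f(ℂ)(unif_q v) = unif'_{q'}(γ^τ v)` on the cone (§3), a complex `k`-form `α` on `X'^an_{q'}`, vectors
`v₀, t₁, …, t_k ∈ ℂ²` and a matrix `u` with `u v₀` negative for `J⋆^τ`: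
`((f^an)^* α)_{ψ_q(u v₀)}(dψ_q(u t₁), …) = α_{ψ'_{q'}((γ^τ u) v₀)}(dψ'_{q'}((γ^τ u) t₁), …)` — the cone function of the pulled-back form is
the cone function of the form read at `γ^τ · u` (★ M4a `pullback_coneDeriv_mulVec_eq'`; `γ^τ` preserves the common cone `negCone (J⋆^τ)`).
With ★ `UnitaryGroupAdelicLiftTranslate` §4 this is «the adelic function of `T(g)^* α` is `R_g` of the adelic function of `α`».
[cite: Milne2005ShimuraVarieties, §5 p. 57–58 and §13 p. 118 L21–26] [cite: VoisinHodgeI2002, §2.2.1 and §7.3.2] -/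
theorem pullback_coneDeriv_ratToGLℂ_eq {q : Q} {q' : Q'} (hHq : (B q).Hℂ = Jstar.map τ) (hHq' : (B' q').Hℂ = Jstar.map τ)
    (A' : HodgeModel 1 (X' q')) (A₁ : HodgeModel 1 (X q))
    {γ : ↥(rational (↥(maximalRealSubfield L)) L (IsCMField.complexConj L) 2 Jstar)} {f : X q ⟶ X' q'}
    (hf : ∀ v ∈ (B q).cone, AlgPoints.map f ((B q).unif v) =
      (B' q').unif (((ratToGLℂ L Jstar τ γ : GL (Fin 2) ℂ) : Matrix (Fin 2) (Fin 2) ℂ) *ᵥ v))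
    {k : ℕ} (α : MForm 𝓘(ℝ, A'.model) A'.carrier ℂ k) (v₀ : Fin 2 → ℂ) (t : Fin k → (Fin 2 → ℂ))
    {u : Matrix (Fin 2) (Fin 2) ℂ} (hu : u *ᵥ v₀ ∈ negCone (Jstar.map τ)) :
    (α.pullback 𝓘(ℝ, A₁.model) (HodgeModel.anMap A' A₁ f)) ((⇑A₁.isAnalytification.homeomorph.symm ∘ (B q).unif) (u *ᵥ v₀))
        (fun i ↦ mfderiv 𝓘(ℝ, Fin 2 → ℂ) 𝓘(ℝ, A₁.model) (⇑A₁.isAnalytification.homeomorph.symm ∘ (B q).unif)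
          (u *ᵥ v₀) (u *ᵥ t i)) =
      α ((⇑A'.isAnalytification.homeomorph.symm ∘ (B' q').unif)
          (((((ratToGLℂ L Jstar τ γ : GL (Fin 2) ℂ) : Matrix (Fin 2) (Fin 2) ℂ)) * u) *ᵥ v₀))
        (fun i ↦ mfderiv 𝓘(ℝ, Fin 2 → ℂ) 𝓘(ℝ, A'.model) (⇑A'.isAnalytification.homeomorph.symm ∘ (B' q').unif)
          (((((ratToGLℂ L Jstar τ γ : GL (Fin 2) ℂ) : Matrix (Fin 2) (Fin 2) ℂ)) * u) *ᵥ v₀)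
          (((((ratToGLℂ L Jstar τ γ : GL (Fin 2) ℂ) : Matrix (Fin 2) (Fin 2) ℂ)) * u) *ᵥ t i)) := by
  have hM : ∀ y ∈ (B q).cone, ((ratToGLℂ L Jstar τ γ : GL (Fin 2) ℂ) : Matrix (Fin 2) (Fin 2) ℂ) *ᵥ y ∈ (B' q').cone := by
    intro y hy
    change y ∈ negCone (B q).Hℂ at hy
    change _ ∈ negCone (B' q').Hℂ
    rw [hHq] at hy
    rw [hHq']
    exact ratToGLℂ_mulVec_mem_negCone' (τ := τ) γ hy
  have hu' : u *ᵥ v₀ ∈ (B q).cone := by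
    change _ ∈ negCone (B q).Hℂ
    rwa [hHq]
  exact (B' q').pullback_coneDeriv_mulVec_eq' A' (B q) A₁ α hf hM v₀ t hu'

end Pieces

/-! ### §5. Classes and forms pulled back along `ι_q ≫ T_ℂ = f ≫ ι'_{q'}` -/

section AnMap

open Literature.AlgebraicTopology.SingularHomology

variable {m n l : ℕ} {Z Y W : SchemeOver ℂ}

/-- **Betti classes along a factorised morphism**: if `f ≫ ι' = φ` (e.g. `φ = ι_q ≫ T_ℂ`, §3) then on complex singular cohomology
`φ(ℂ)^* = f(ℂ)^* ∘ ι'(ℂ)^*` — the class `T(g)^* c` of the whole curve restricted to the piece `q` is the pull-back along the piece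
morphism `f` of `c` restricted to the piece `q'` (functoriality of `X ↦ X(ℂ)`, ★ `AlgPoints.mapContinuous_comp`, and of `H^k(-; ℂ)`).
No smoothness or connectedness of `W` is needed (the compact curve `(M_{K'})_τ` is not connected). [cite: HatcherAT2002, §3.1]
[cite: Milne2005ShimuraVarieties, §13 p. 118 L21–26] -/
theorem singularCohomology_map_mapContinuous_eq_of_comp_eq {ι' : Y ⟶ W} {f : Z ⟶ Y} {φ : Z ⟶ W} (h : f ≫ ι' = φ) (k : ℕ)
    (c : singularCohomology ℂ ℂ (Motives.ComplexPoints W) k) :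
    singularCohomology.map ℂ ℂ (AlgPoints.mapContinuous (L := ℂ) φ) k c =
      singularCohomology.map ℂ ℂ (AlgPoints.mapContinuous (L := ℂ) f) k
        (singularCohomology.map ℂ ℂ (AlgPoints.mapContinuous (L := ℂ) ι') k c) := by
  subst h
  rw [AlgPoints.mapContinuous_comp, singularCohomology.map_comp]
  rfl

/-- `(f ≫ ι')^an = ι'^an ∘ f^an` as functions of Hodge-model carriers (★ `HodgeModel.anMap_comp_apply`, pointwise ⇒ `funext`).
[cite: SerreGAGA1956, §2 n°5 (fonctorialité de X^h)] -/
theorem anMap_comp_eq (AW : HodgeModel n W) (AY : HodgeModel m Y) (AZ : HodgeModel l Z) (ι' : Y ⟶ W) (f : Z ⟶ Y) :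
    HodgeModel.anMap AW AZ (f ≫ ι') = HodgeModel.anMap AW AY ι' ∘ HodgeModel.anMap AY AZ f :=
  funext fun z => HodgeModel.anMap_comp_apply AW AY AZ ι' f z

/-- **Forms along a factorised morphism of smooth projective varieties**: if `f ≫ ι' = φ` with `Z`, `Y`, `W` smooth projective (so
the analytified maps are holomorphic, GAGA ★ `HodgeModel.mdifferentiable_anMap`), then for every complex `k`-form `β` on `W^an`:
`(φ^an)^* β = (f^an)^* ((ι'^an)^* β)` (★ `MForm.pullback_comp`) — the form-level companion of the previous lemma for CONNECTED targets
(a Hecke self-correspondence of one compact ball quotient, the sub-ball embeddings `C → S` of ★ `UnitaryBallConeFormPullback` §3).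
[cite: VoisinHodgeI2002, §2.2.1 and §7.3.2] [cite: SerreGAGA1956, §2 n°5 (fonctorialité de X^h)] -/
theorem pullback_anMap_eq_pullback_pullback_of_comp_eq (AW : HodgeModel n W) (AY : HodgeModel m Y) (AZ : HodgeModel l Z)
    (hW : Motives.IsSmoothProjective n W) (hY : Motives.IsSmoothProjective m Y) (hZ : Motives.IsSmoothProjective l Z)
    {ι' : Y ⟶ W} {f : Z ⟶ Y} {φ : Z ⟶ W} (h : f ≫ ι' = φ) {k : ℕ} (β : MForm 𝓘(ℝ, AW.model) AW.carrier ℂ k) :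
    β.pullback 𝓘(ℝ, AZ.model) (HodgeModel.anMap AW AZ φ) =
      (β.pullback 𝓘(ℝ, AY.model) (HodgeModel.anMap AW AY ι')).pullback 𝓘(ℝ, AZ.model) (HodgeModel.anMap AY AZ f) := by
  rw [← h, anMap_comp_eq AW AY AZ ι' f]
  exact MForm.pullback_comp (fun y => ((HodgeModel.mdifferentiable_anMap AW AY ι' hY hW) y).real_of_complex)
    (fun z => ((HodgeModel.mdifferentiable_anMap AY AZ f hZ hY) z).real_of_complex) β

end AnMap

end Literature.AlgebraicGeometry.ShimuraVarieties.UnitaryCanonicalModel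

end
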